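import Literature.AnabelianGeometry.EtaleTheta.LogDivisorModelTateTowerThetaTwistTower
import Literature.AnabelianGeometry.EtaleTheta.LogDivisorTowerRestrict

/-!
# [EtTh] Def. 3.3 (iii), Tate tower v3 piece 2c: the ε-FREE sign-free tower `towerC₃sf` of the `Ÿ`-skeleton over «GRP₃′» — the
# tower of record for E2 / the root law (route (R2) of the «E2 obstruction of the sign passenger»; class (b))

S. Mochizuki, *The étale theta function …*, Publ. RIMS **45** (2009) [MochizukiEtTh2009], Def. 3.3 (iii) pp.73–74; ERRATUM E2 =
[IUTchI] Rmk. 3.2.4 (i)(a) [cite: MochizukiEtTh2009, Def 3.3 (iii) p.73].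

CLASS (b) MODEL (abc-iut cell, layer L2; seat abc-iut-L2-t3 (gen 7); sequel of `…ThetaTwistTower` (`towerC₃`, p487602) and
`LogDivisorTowerRestrict` (generic restriction) — both UNTOUCHED).  WHY (this seat's FINDING #4, STATUS 2026-08-27 ≈02:50Z): the levels of
`towerC₃` keep the level-`0` sign coordinate `ε ∈ μ₂` of the `Ÿ`-skeleton's exponent vectors as a silent passenger (fixed by every
action, kept by every transition), so the constant family «−1» `= (1, ε = 1, 0)` has no `N`-th root at any level for even `N` and E2 (a)
FAILS on `towerC₃`.  Under design (β) («sign-free», abc-iut-L2-lead gen 7 R922) the sign must be ABSENT from the levels: THIS FILE carves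
the ε-free sub-tower out of `towerC₃`:
* `epsKer B ≤ Fn μ` — the functions with trivial sign coordinate; stable under the Kummer classes, the constants, the sign-fixed
  translations (`fst_shear₀`), hence under «GRP₃′» at every modulus (`levelActFnMod_mem_epsKer`), and under every transition
  (`resFn_mem_epsKer`: `resExp` keeps the sign);
* **`towerC₃sf := towerC₃.restrict (fun n => epsKer (ZMod (N n))) …`** — a `LogDivisorTower (Compat 3 thetaShear) (levelsC 3 thetaShear)`
  whose level-`n` functions are `μ_{N n} × ⟨ϖ̈_n⟩ × ⟨Ü_n⟩ × ⟨Θ̈_n⟩` (no `μ₂` passenger); «−1» now lives in `μ_{N n}` (`n ≥ 1`) and acquires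
  roots as the modulus grows — the root law (file 3) and the tf over `B^temp(Compat)⁰` (file 4) are to be built over `towerC₃sf`.
DEVIATION OF RECORD (design (β), R922): the torsion sign `(−1)^a` of [EtTh] Prop. 1.4 (ii) is NOT carried by the level translations;
print carries signs inside `O^×_K̈ · η̈^Θ` / the `(l·ℤ × μ₂)`-orbit classes; sign-blind uses only.  HONEST LABEL: class-(b) design
model, NOT the tempered tower of a Tate curve; nothing here bears on [IUTchIII] Cor. 3.12; no side taken; typed ≠ proved.
-/

noncomputable section

namespace Literature.AnabelianGeometry.EtaleTheta

open CategoryTheory Function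

namespace LogDivisorModel

namespace TateTowerThetaTwist

open TateTowerTheta
open TateTowerKummerTwist (M Cst N N_dvd_M eN MuN upAdd)
open TateTowerKummerTwistR (Kum)
open TateTowerKummerTwistRShear (Grp thetaShear compat Compat levelsC)

variable (B : Type) [AddCommGroup B]

/-- **The ε-free functions of a level**: trivial sign coordinate. [cite: MochizukiEtTh2009, Def 3.3 (iii) p.73] -/
def epsKer : Subgroup (Fn (Multiplicative B)) where
  carrier := {x | (Multiplicative.toAdd x.2).1 = 0}
  one_mem' := rfl
  mul_mem' {x y} hx hy := by
    change (Multiplicative.toAdd x.2).1 + (Multiplicative.toAdd y.2).1 = 0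
    rw [hx, hy, add_zero]
  inv_mem' {x} hx := by
    change -(Multiplicative.toAdd x.2).1 = 0
    rw [hx, neg_zero]

variable {B}

/-- Membership in `epsKer`. [cite: MochizukiEtTh2009, Def 3.3 (iii) p.73] -/
theorem mem_epsKer_iff (x : Fn (Multiplicative B)) : x ∈ epsKer B ↔ (Multiplicative.toAdd x.2).1 = 0 := Iff.rfl

/-- The Kummer classes preserve `epsKer` (they fix the skeleton part). [cite: MochizukiEtTh2009, Def 3.3 p.73] -/
theorem kummerAut_mem_epsKer (κ : Fin 3 → B) {x : Fn (Multiplicative B)} (hx : x ∈ epsKer B) : kummerAut κ x ∈ epsKer B := hx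

/-- The constants preserve `epsKer`. [cite: MochizukiEtTh2009, Def 3.3 p.73] -/
theorem constAction_mem_epsKer (φ : MulAut (Multiplicative B)) {x : Fn (Multiplicative B)} (hx : x ∈ epsKer B) :
    constAction φ x ∈ epsKer B := hx

/-- The sign-fixed translations preserve `epsKer`. [cite: MochizukiEtTh2009, Prop 1.4 p.22] -/
theorem translAut_mem_epsKer (η : B) (a : ℤ) {x : Fn (Multiplicative B)} (hx : x ∈ epsKer B) : translAut η a x ∈ epsKer B := by
  change (shear₀ a (Multiplicative.toAdd x.2)).1 = 0
  rw [fst_shear₀]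
  exact hx

/-- «GRP₃′» at any modulus preserves `epsKer`. [cite: MochizukiEtTh2009, Def 3.3 p.73] -/
theorem levelActFnMod_mem_epsKer (n d : ℕ) (hd : d ∣ M n) (g : Grp 3 thetaShear) {x : Fn (Multiplicative (ZMod d))}
    (hx : x ∈ epsKer (ZMod d)) : levelActFnMod n d hd g x ∈ epsKer (ZMod d) := by
  rw [levelActFnMod_apply, MulAut.mul_apply, MulAut.mul_apply, kumActMod_apply, translAction_apply]
  exact kummerAut_mem_epsKer _ (constAction_mem_epsKer _ (translAut_mem_epsKer _ _ hx))

/-- Every transition preserves `epsKer` (`resExp` keeps the sign). [cite: MochizukiEtTh2009, Def 3.3 (iii) p.74] -/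
theorem resFn_mem_epsKer {B' : Type} [AddCommGroup B'] (ι : B →+ B') (e : ℕ) {x : Fn (Multiplicative B)} (hx : x ∈ epsKer B) :
    resFn ι e x ∈ epsKer B' := hx

/-- **The ε-free sign-free Kummer tower of the `Ÿ`-skeleton over «GRP₃′»** — the (β) tower of record for E2: `towerC₃` restricted to the
functions with trivial sign coordinate at every level. [cite: MochizukiEtTh2009, Def 3.3 (iii) p.73] -/
def towerC₃sf : LogDivisorTower (Compat 3 thetaShear) (levelsC 3 thetaShear) :=
  towerC₃.restrict (fun n => epsKer (ZMod (N n)))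
    (fun n g _ hf => levelActFnMod_mem_epsKer n (N n) (N_dvd_M n) (g : Grp 3 thetaShear) hf)
    (fun _ _ hf => resFn_mem_epsKer _ _ hf)

/-- The levels of `towerC₃sf` are the ε-free restrictions of the `Ÿ`-levels. [cite: MochizukiEtTh2009, Def 3.3 (iii) p.73] -/
theorem towerC₃sf_Z (n : ℕ) : towerC₃sf.Z n = (model (MuN n)).restrict (epsKer (ZMod (N n))) := rfl

/-- **No sign passenger is left**: every function of every level of `towerC₃sf` has trivial sign coordinate.
[cite: MochizukiEtTh2009, Def 3.3 (iii) p.73] -/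
theorem fst_eq_zero_of_towerC₃sf (n : ℕ) (f : (towerC₃sf.Z n).Fn) : (Multiplicative.toAdd f.1.2).1 = 0 := f.2

/-- The roots `ϖ̈_n`, `Ü_n`, `Θ̈_n` and every root of unity are ε-free (the restricted levels lose nothing but the sign).
[cite: MochizukiEtTh2009, Def 3.3 (iii) p.73] -/
theorem generators_mem_epsKer (B : Type) [AddCommGroup B] (ζ : Multiplicative B) :
    unif (Multiplicative B) ∈ epsKer B ∧ coordU (Multiplicative B) ∈ epsKer B ∧ theta (Multiplicative B) ∈ epsKer B ∧
      zeta (Multiplicative B) ζ ∈ epsKer B :=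
  ⟨rfl, rfl, rfl, rfl⟩

end TateTowerThetaTwist

end LogDivisorModel

end Literature.AnabelianGeometry.EtaleTheta

end
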